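import Mathlib
import Summits.Langlands.Langlands.Theses.NonParallelVoid
import Summits.Langlands.Langlands.Theorems.NonParallelVoidTensorSquareParallelStubLabelExtension
import Literature.NumberTheory.GaloisRepresentations.PstCrystallineExtensionData
import Literature.NumberTheory.GaloisRepresentations.EnormousSubgroup
import Literature.NumberTheory.GaloisRepresentations.ProjectiveType
import Literature.NumberTheory.GaloisRepresentations.DecomposedGeneric
import Literature.NumberTheory.GaloisRepresentations.AbsGaloisGroup
import Literature.NumberTheory.GaloisRepresentations.AbsGaloisOuterConj
import Literature.NumberTheory.GaloisRepresentations.PadicComplexEmbedding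
import Literature.NumberTheory.GaloisRepresentations.ToLocalRestrictField
import Literature.NumberTheory.Automorphic.Qian2022PotentialAutomorphy
import Literature.NumberTheory.Automorphic.ClozelPurityProofs
import Literature.NumberTheory.Automorphic.AHTW2026HodgeTateWeights
import Literature.NumberTheory.PAdicHodge.LabelledHodgeTateWeightsBaseChangeLabelwise
import Literature.NumberTheory.PAdicHodge.CrystallineBaseChange
import HarnessLib

/-!
# Stub `stub_ordinaryDihedralVoid` of line `merged` (skeleton v2) for crux `TensorSquareParallel`
# (stmt-Langlands-17009): the nearly-ordinary dihedral corner is void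

The NEARLY-ORDINARY DIHEDRAL CORNER of the crux is empty.  For an imaginary quadratic field `F`, a
prime `p` SPLIT in `F` and `ρ : Γ_F → GL₂(ℚ̄_p)` which is a.e. unramified, crystalline with labelled
Hodge–Tate weights `{a < b}` and an invariant line at every `v ∣ p`, and carries Qian's residual
package, the composition is:

* **Part B** (`exists_isAutomorphic_restrictField`): Qian 2023, Thm. 1.4 (antecedent `hQ`, the named
  fact `Qian2022.potentialAutomorphy_ordinary` at the PINNED `p`-adic Hodge data
  `fontainePstAdicCompletion` and a family of local Artin data `𝓐`), fed with the local lemma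
  "near-ordinary ⇒ Qian-ordinary with regular weights at split `p`" (antecedent `hOrd`), makes
  `ρ|_{Γ_{K'}}` automorphic (`Qian2022.IsAutomorphic ι`) over a CM field `K'` Galois over `F`, for
  some `ι : ℚ̄_p ≃ ℂ` (`nonempty_algebraicClosure_padic_ringEquiv_complex`; `F` is CM by
  `IsCMField.ofCMExtension`).
* **Part A** (`false_of_isAutomorphic_of_gap_ne`): AHTW 2026, Thm. 1.2.1 (antecedent `hHTπ`,
  `AHTW2026.hodgeTateWeights_eq`: exact labelled weights of `r_ι(π)` read off the infinity type),
  label-wise base change of labelled weights (antecedent `hBC`,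
  `LabelledHodgeTateWeightsBaseChangeLabelwise`, through its proved global corollary
  `labelledHodgeTateWeightsAt_restrictField_eq_comp_of_liesOver`), the label-extension plumbing
  `stub_labelExtension` (PROVED, p169377), Clozel's purity lemma `CuspidalAutomorphicRepData.purity`
  (PROVED in the tree) and "two complex embeddings of an imaginary quadratic field are equal or
  conjugate" force EQUAL GAPS `b − a` at any two labels of `F` above `p` — contradicting `hNP`.

All four deep inputs are ANTECEDENTS of the registered signature (supplied at the call site by the
neighbour `stub_externalInputs`); nothing is assumed here.
-/

noncomputable section

set_option linter.dupNamespace false  -- `Summit.Langlands.Langlands.…` is the mandated summit-side namespace (D-0022)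

open scoped NumberField
open IsDedekindDomain Field NumberField
open Literature.NumberTheory.GaloisRepresentations Literature.NumberTheory.PAdicHodge
  Literature.NumberTheory.Automorphic

namespace Summit.Langlands.Langlands.Theorems.TensorSquareParallel

/-! ### Elementary lemmas -/

/-- In an imaginary quadratic field any two complex embeddings are equal or complex conjugate
(there are exactly `[F : ℚ] = 2` embeddings and none is real). [folklore] -/
theorem embedding_eq_or_eq_conjugate (F : Type) [Field F] [NumberField F]
    [Algebra.IsQuadraticExtension ℚ F] [IsTotallyComplex F] (s s' : F →+* ℂ) :
    s' = s ∨ s' = ComplexEmbedding.conjugate s := by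
  classical
  by_contra hcon
  push Not at hcon
  have hne : ComplexEmbedding.conjugate s ≠ s := fun h =>
    IsTotallyComplex.complexEmbedding_not_isReal s (ComplexEmbedding.isReal_iff.2 h)
  have hcard : Fintype.card (F →+* ℂ) = 2 := by
    rw [NumberField.Embeddings.card, Algebra.IsQuadraticExtension.finrank_eq_two ℚ F]
  have h3 : ({s', s, ComplexEmbedding.conjugate s} : Finset (F →+* ℂ)).card = 3 := by
    rw [Finset.card_insert_of_notMem, Finset.card_insert_of_notMem, Finset.card_singleton]
    · simpa using hne.symm
    · simp only [Finset.mem_insert, Finset.mem_singleton, not_or]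
      exact ⟨hcon.1, hcon.2⟩
  have := Finset.card_le_univ ({s', s, ComplexEmbedding.conjugate s} : Finset (F →+* ℂ))
  omega

/-- Two-element multisets of integers with increasing entries are equal iff entrywise equal.
[folklore] -/
theorem pair_eq_pair_of_lt {a b a' b' : ℤ} (hab : a < b) (hab' : a' < b')
    (h : ({a, b} : Multiset ℤ) = {a', b'}) : a = a' ∧ b = b' := by
  have hsum : a + b = a' + b' := by
    have := congrArg Multiset.sum h
    simpa using this
  have ha : a ∈ ({a', b'} : Multiset ℤ) := by rw [← h]; simp
  simp only [Multiset.insert_eq_cons, Multiset.mem_cons, Multiset.mem_singleton] at ha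
  rcases ha with rfl | rfl
  · exact ⟨rfl, by omega⟩
  · omega

/-- The `ℂ`-cast of a two-element multiset of integers. [folklore] -/
theorem map_intCast_pair (a b : ℤ) :
    (({a, b} : Multiset ℤ).map fun h : ℤ => (h : ℂ)) = {(a : ℂ), (b : ℂ)} := by
  simp

/-! ### Part B — Qian's theorem at the pinned data: `ρ|_{Γ_{K'}}` is automorphic over a CM `K'` -/

/-- **Part B.**  Under `hQ` (Qian 2023 Thm. 1.4 at the pinned Hodge data `fontainePstAdicCompletion`
and the Artin data `𝓐`) and the local lemma `hOrd` ("near-ordinary ⇒ ordinary with regular weights at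
split `p`", Qian Def. 1.2): an a.e.-unramified `ρ : Γ_F → GL₂(ℚ̄_p)` over an imaginary quadratic `F`,
`p` split, de Rham with labelled weights `{a < b}`, crystalline, with an invariant line at every
`v ∣ p`, and carrying Qian's residual package, becomes automorphic (`Qian2022.IsAutomorphic ι`) over a
CM number field `K'` Galois over `F`, for some `ι : ℚ̄_p ≃ ℂ`.
[cite: Qian2022, Thm. 1.4 (with Def. 1.2, Def. 1.3)] -/
theorem exists_isAutomorphic_restrictField
    (𝓐 : ∀ (K : Type) [Field K] [NumberField K] (v : HeightOneSpectrum (𝓞 K)),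
      LocalArtinData (v.adicCompletion K))
    (hQ : Qian2022.potentialAutomorphy_ordinary 𝓐
      (fun (K : Type) (_ : Field K) (_ : NumberField K) (p : ℕ) (_ : Fact p.Prime)
        (v : HeightOneSpectrum (𝓞 K)) (hv : ((p : ℕ) : 𝓞 K) ∈ v.asIdeal) =>
          fontainePstAdicCompletion v p hv))
    (hOrd : ∀ (F : Type) [Field F] [NumberField F] [Algebra.IsQuadraticExtension ℚ F] (p : ℕ)
      [Fact p.Prime] (ρ : FramedGaloisRep F (PadicAlgCl p) 2),
      (∃ v w : HeightOneSpectrum (𝓞 F), v ≠ w ∧ ((p : ℕ) : 𝓞 F) ∈ v.asIdeal ∧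
        ((p : ℕ) : 𝓞 F) ∈ w.asIdeal) →
      ∀ (v : HeightOneSpectrum (𝓞 F)) (hv : ((p : ℕ) : 𝓞 F) ∈ v.asIdeal),
        (fontainePstAdicCompletion v p hv).IsCrystallineFramed (ρ.toLocal v) →
        (letI := (fontainePstAdicCompletion v p hv).algebra
         ∀ τ : v.adicCompletion F →ₐ[ℚ_[p]] PadicAlgCl p, ∃ a b : ℤ, a < b ∧
           ρ.labelledHodgeTateWeightsAt v (fontainePstAdicCompletion v p hv).algebra
             (fontainePstAdicCompletion v p hv).𝔅 τ.toRingHom = {a, b}) →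
        FramedRep.HasInvariantCompleteFlag (ρ.toLocal v) → ρ.IsOrdinaryRegularAt v (𝓐 F v))
    (F : Type) [Field F] [NumberField F] [Algebra.IsQuadraticExtension ℚ F]
    (hF : NumberField.IsTotallyComplex F) (p : ℕ) [Fact p.Prime]
    (ρ : FramedGaloisRep F (PadicAlgCl p) 2)
    (hsplit : ∃ v w : HeightOneSpectrum (𝓞 F), v ≠ w ∧ ((p : ℕ) : 𝓞 F) ∈ v.asIdeal ∧
      ((p : ℕ) : 𝓞 F) ∈ w.asIdeal)
    (hunr : ∀ᶠ v : HeightOneSpectrum (𝓞 F) in Filter.cofinite, ρ.IsUnramifiedAt v)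
    (hHT : ∀ (v : HeightOneSpectrum (𝓞 F)) (hv : ((p : ℕ) : 𝓞 F) ∈ v.asIdeal),
      (fontainePstAdicCompletion v p hv).IsDeRhamFramed (ρ.toLocal v) ∧
      (letI := (fontainePstAdicCompletion v p hv).algebra
       ∀ τ : v.adicCompletion F →ₐ[ℚ_[p]] PadicAlgCl p, ∃ a b : ℤ, a < b ∧
         ρ.labelledHodgeTateWeightsAt v (fontainePstAdicCompletion v p hv).algebra
           (fontainePstAdicCompletion v p hv).𝔅 τ.toRingHom = {a, b}))
    (hcrys : ∀ (v : HeightOneSpectrum (𝓞 F)) (hv : ((p : ℕ) : 𝓞 F) ∈ v.asIdeal),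
      (fontainePstAdicCompletion v p hv).IsCrystallineFramed (ρ.toLocal v))
    (hLR : ∀ v : HeightOneSpectrum (𝓞 F), ((p : ℕ) : 𝓞 F) ∈ v.asIdeal →
      FramedRep.HasInvariantCompleteFlag (ρ.toLocal v))
    (hpkg : ρ.IsResidualRepOf (RingHom.id _) ρ.residualRep ∧ IsAbsIrreducible ρ.residualRep ∧
      IsDecomposedGeneric ρ.residualRep ∧
      IsAbsIrreducible (ρ.residualRep.comp (absGaloisGroupAdjoinRootsOfUnity F p).subtype) ∧
      Subgroup.IsEnormous ((absGaloisGroupAdjoinRootsOfUnity F p).map ρ.residualRep) ∧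
      ∃ σ : absoluteGaloisGroup F, σ ∉ absGaloisGroupAdjoinRootsOfUnity F p ∧
        ∃ c : padicAlgClResidueField p,
          ((ρ.residualRep σ : GL (Fin 2) (padicAlgClResidueField p)) :
            Matrix (Fin 2) (Fin 2) (padicAlgClResidueField p)) =
            c • (1 : Matrix (Fin 2) (Fin 2) (padicAlgClResidueField p))) :
    ∃ (ι : PadicAlgCl p ≃+* ℂ) (K' : Type) (_ : Field K') (_ : NumberField K') (_ : Algebra F K'),
      IsGalois F K' ∧ IsCMField K' ∧ Qian2022.IsAutomorphic ι (ρ.restrictField K') := by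
  haveI := hF
  -- `F` is CM (imaginary quadratic)
  have hCM : IsCMField F := IsCMField.ofCMExtension ℚ F
  -- `ι : ℚ̄_p ≃ ℂ`
  obtain ⟨ι⟩ := NumberField.nonempty_algebraicClosure_padic_ringEquiv_complex p
  -- hypothesis (ii): de Rham + ordinary-regular at every `v ∣ p`
  have hii : ∀ (v : HeightOneSpectrum (𝓞 F)) (hv : ((p : ℕ) : 𝓞 F) ∈ v.asIdeal),
      (fontainePstAdicCompletion v p hv).IsDeRhamFramed (ρ.toLocal v) ∧
        ρ.IsOrdinaryRegularAt v (𝓐 F v) :=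
    fun v hv => ⟨(hHT v hv).1, hOrd F p ρ hsplit v hv (hcrys v hv) (hHT v hv).2 (hLR v hv)⟩
  -- hypotheses (iii)–(iv): the residual package with `τ = ρ.residualRep`
  obtain ⟨K', iF, iN, iA, hGal, hCM', -, hAut⟩ :=
    hQ F hCM F (FiniteDimensional.finiteDimensional_self F) 2 le_rfl p ι ρ hunr hii
      ⟨ρ.residualRep, hpkg⟩
  exact ⟨ι, K', iF, iN, iA, hGal, hCM', hAut⟩

/-! ### Part A — automorphy over a CM `K'` + exact weights + purity ⇒ the two gaps agree -/

/-- **Part A.**  Under the exact-weights fact `hHTπ` (AHTW 2026 Thm. 1.2.1 at the pinned data) and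
the label-by-label base change `hBC` (Brinon–Conrad 6.3.8): if `ρ|_{Γ_{K'}}` is automorphic
(`Qian2022.IsAutomorphic ι`, `K'` CM) then any two labels of the imaginary quadratic `F` above `p`
at which `ρ` has two labelled weights have THE SAME GAP — a label `(v, τ)` of `F` and an extension
`e : K' → ℚ̄_p` of `τ|_F` give a label `(w, τ')` of `K'` above it (`stub_labelExtension`), where the
weights of `ρ|_{Γ_{K'}}` are those of `ρ` at `(v, τ)` (`hBC`) and equal `{1/2 − x : x ∈ A_T(ι e)}`
(`hHTπ`); Clozel's purity lemma (`CuspidalAutomorphicRepData.purity`, a theorem of the tree) makes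
the `a`-multisets of the infinity type at complex-conjugate embeddings reflections of each other, and
the two complex embeddings of `F` are equal or conjugate.  Hence `False` from two labels with
different gaps. [cite: Clozel1990, Lemme 4.9] [cite: AHTW2026, Thm. 1.2.1]
[cite: BrinonConrad2009, Prop. 6.3.8] -/
theorem false_of_isAutomorphic_of_gap_ne
    (hHTπ : AHTW2026.hodgeTateWeights_eq
      (fun (K : Type) (_ : Field K) (_ : NumberField K) (p : ℕ) (_ : Fact p.Prime)
        (v : HeightOneSpectrum (𝓞 K)) (hv : ((p : ℕ) : 𝓞 K) ∈ v.asIdeal) =>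
          fontainePstAdicCompletion v p hv))
    (hBC : LabelledHodgeTateWeightsBaseChangeLabelwise)
    (F : Type) [Field F] [NumberField F] [Algebra.IsQuadraticExtension ℚ F]
    (hF : NumberField.IsTotallyComplex F) (p : ℕ) [Fact p.Prime]
    (ρ : FramedGaloisRep F (PadicAlgCl p) 2)
    (hNP : ∃ (v : HeightOneSpectrum (𝓞 F)) (hv : ((p : ℕ) : 𝓞 F) ∈ v.asIdeal)
      (w : HeightOneSpectrum (𝓞 F)) (hw : ((p : ℕ) : 𝓞 F) ∈ w.asIdeal),
      letI := (fontainePstAdicCompletion v p hv).algebra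
      letI := (fontainePstAdicCompletion w p hw).algebra
      ∃ (τ : v.adicCompletion F →ₐ[ℚ_[p]] PadicAlgCl p) (σ : w.adicCompletion F →ₐ[ℚ_[p]] PadicAlgCl p)
        (a b a' b' : ℤ),
        ρ.labelledHodgeTateWeightsAt v (fontainePstAdicCompletion v p hv).algebra
            (fontainePstAdicCompletion v p hv).𝔅 τ.toRingHom = {a, b} ∧ a < b ∧
          ρ.labelledHodgeTateWeightsAt w (fontainePstAdicCompletion w p hw).algebra
            (fontainePstAdicCompletion w p hw).𝔅 σ.toRingHom = {a', b'} ∧ a' < b' ∧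
          b - a ≠ b' - a')
    (ι : PadicAlgCl p ≃+* ℂ) (K' : Type) [Field K'] [NumberField K'] [Algebra F K']
    (hCM' : IsCMField K') (hAut : Qian2022.IsAutomorphic ι (ρ.restrictField K')) : False := by
  haveI := hF
  obtain ⟨hss, hcpt, π, ⟨T, hT, hTreg⟩, hcompat⟩ := hAut
  obtain ⟨w₀, hpur⟩ := CuspidalAutomorphicRepData.purity π hT hTreg
  -- KEY: for an `F`-label `(v, τ)` with weights `{a, b}` and an extension `e : K' → ℚ̄_p` of `τ|_F`,
  -- `{a, b} = {1/2 − x : x ∈ A_T(ι ∘ e)}` in `ℂ`.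
  have key : ∀ (v : HeightOneSpectrum (𝓞 F)) (hv : ((p : ℕ) : 𝓞 F) ∈ v.asIdeal)
      (τ : @AlgHom ℚ_[p] (v.adicCompletion F) (PadicAlgCl p) _ _ _
        (fontainePstAdicCompletion v p hv).algebra _) (a b : ℤ),
      ρ.labelledHodgeTateWeightsAt v (fontainePstAdicCompletion v p hv).algebra
          (fontainePstAdicCompletion v p hv).𝔅
          (@AlgHom.toRingHom ℚ_[p] (v.adicCompletion F) (PadicAlgCl p) _ _ _
            (fontainePstAdicCompletion v p hv).algebra _ τ) = {a, b} →
      ∀ e : K' →+* PadicAlgCl p,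
        e.comp (algebraMap F K') =
          (@AlgHom.toRingHom ℚ_[p] (v.adicCompletion F) (PadicAlgCl p) _ _ _
            (fontainePstAdicCompletion v p hv).algebra _ τ).comp
            (algebraMap F (v.adicCompletion F)) →
        ({(a : ℂ), (b : ℂ)} : Multiset ℂ) =
          ((T (ι.toRingHom.comp e)).map ArchWeight.a).map
            (fun x : ℂ => (((2 : ℕ) : ℂ) - 1) / 2 - x) := by
    intro v hv τ a b hab e he
    letI := (fontainePstAdicCompletion v p hv).algebra
    obtain ⟨w, hwv, hw, τ', hτ'e, hτ'τ⟩ := stub_labelExtension F K' p v hv τ e he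
    letI := (fontainePstAdicCompletion w p hw).algebra
    have hBC' := labelledHodgeTateWeightsAt_restrictField_eq_comp_of_liesOver hBC ρ v w hv hw τ'
    rw [hτ'τ, hab] at hBC'
    have hA := hHTπ K' hCM' 2 (by norm_num) hcpt π T hT hTreg p ι (ρ.restrictField K') hss hcompat
      w hw τ'
    rw [hBC', map_intCast_pair] at hA
    have hemb : ι.toRingHom.comp (τ'.toRingHom.comp (algebraMap K' (w.adicCompletion K'))) =
        ι.toRingHom.comp e := by rw [hτ'e]
    rw [hemb] at hA
    exact hA
  obtain ⟨v, hv, w, hw, τ, σ, a, b, a', b', hab, hlt, hab', hlt', hne⟩ := hNP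
  letI := (fontainePstAdicCompletion v p hv).algebra
  letI := (fontainePstAdicCompletion w p hw).algebra
  -- extend the global embedding `τ|_F` to `K'`
  letI algF : Algebra F (PadicAlgCl p) :=
    (τ.toRingHom.comp (algebraMap F (v.adicCompletion F))).toAlgebra
  haveI : Module.Finite F K' := Module.Finite.of_restrictScalars_finite ℚ F K'
  haveI : Algebra.IsAlgebraic F K' := Algebra.IsAlgebraic.of_finite F K'
  let eA : K' →ₐ[F] PadicAlgCl p := IsAlgClosed.lift
  have heA : (eA : K' →+* PadicAlgCl p).comp (algebraMap F K') =
      τ.toRingHom.comp (algebraMap F (v.adicCompletion F)) := eA.comp_algebraMap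
  have heAx : ∀ x : F, eA (algebraMap F K' x) = τ (algebraMap F (v.adicCompletion F) x) :=
    fun x => RingHom.congr_fun heA x
  have k1 := key v hv τ a b hab eA heA
  -- the two complex embeddings of `F` induced by the labels
  have hdich := embedding_eq_or_eq_conjugate F
    (ι.toRingHom.comp (τ.toRingHom.comp (algebraMap F (v.adicCompletion F))))
    (ι.toRingHom.comp (σ.toRingHom.comp (algebraMap F (w.adicCompletion F))))
  rcases hdich with h | h
  · -- same embedding: `eA` also extends `σ|_F`
    have hx : ∀ x : F, σ (algebraMap F (w.adicCompletion F) x) =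
        τ (algebraMap F (v.adicCompletion F) x) := fun x =>
      ι.injective (by simpa using RingHom.congr_fun h x)
    have heA' : (eA : K' →+* PadicAlgCl p).comp (algebraMap F K') =
        σ.toRingHom.comp (algebraMap F (w.adicCompletion F)) :=
      RingHom.ext fun x => (heAx x).trans (hx x).symm
    have k2 := key w hw σ a' b' hab' eA heA'
    rw [← k1, ← map_intCast_pair, ← map_intCast_pair] at k2
    have hZ := Multiset.map_injective Int.cast_injective k2
    obtain ⟨rfl, rfl⟩ := pair_eq_pair_of_lt hlt' hlt hZ
    exact hne rfl
  · -- conjugate embeddings: twist the extension by `ι⁻¹ ∘ conj ∘ ι`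
    let e₂ : K' →+* PadicAlgCl p :=
      ι.symm.toRingHom.comp ((starRingEnd ℂ).comp (ι.toRingHom.comp (eA : K' →+* PadicAlgCl p)))
    have he₂x : ∀ y : K', ι (e₂ y) = (starRingEnd ℂ) (ι (eA y)) := fun y => by simp [e₂]
    have hι : ι.toRingHom.comp e₂ =
        (starRingEnd ℂ).comp (ι.toRingHom.comp (eA : K' →+* PadicAlgCl p)) :=
      RingHom.ext fun y => by simpa using he₂x y
    have hx : ∀ x : F, ι (σ (algebraMap F (w.adicCompletion F) x)) =
        (starRingEnd ℂ) (ι (τ (algebraMap F (v.adicCompletion F) x))) := fun x => by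
      simpa [ComplexEmbedding.conjugate_coe_eq] using RingHom.congr_fun h x
    have he₂ : e₂.comp (algebraMap F K') =
        σ.toRingHom.comp (algebraMap F (w.adicCompletion F)) := by
      refine RingHom.ext fun x => ι.injective ?_
      change ι (e₂ (algebraMap F K' x)) = ι (σ (algebraMap F (w.adicCompletion F) x))
      rw [he₂x, heAx, hx]
    have k2 := key w hw σ a' b' hab' e₂ he₂
    rw [hι, hpur (ι.toRingHom.comp (eA : K' →+* PadicAlgCl p))] at k2
    -- `k1 : {a, b} = A.map f`, `k2 : {a', b'} = (A.map (w₀ − ·)).map f`, `f x = 1/2 − x`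
    have k3 : ({(a' : ℂ), (b' : ℂ)} : Multiset ℂ) =
        ({(a : ℂ), (b : ℂ)} : Multiset ℂ).map (fun y : ℂ => (1 - (w₀ : ℂ)) - y) := by
      rw [k2, k1]
      simp only [Multiset.map_map, Function.comp_def]
      refine Multiset.map_congr rfl fun x _ => ?_
      push_cast
      ring
    have k4 : ({(a' : ℂ), (b' : ℂ)} : Multiset ℂ) =
        {(((1 - w₀ - a : ℤ)) : ℂ), (((1 - w₀ - b : ℤ)) : ℂ)} := by
      rw [k3]
      simp only [Multiset.insert_eq_cons, Multiset.map_cons, Multiset.map_singleton]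
      push_cast
      rfl
    rw [Multiset.pair_comm (((1 - w₀ - a : ℤ)) : ℂ), ← map_intCast_pair, ← map_intCast_pair] at k4
    have hZ := Multiset.map_injective Int.cast_injective k4
    obtain ⟨rfl, rfl⟩ := pair_eq_pair_of_lt hlt' (by omega) hZ
    exact hne (by ring)

/-! ### The stub -/

/-- **`stub_ordinaryDihedralVoid` — the nearly-ordinary dihedral corner of the crux is void.**  For a
family of local Artin data `𝓐`, ASSUMING (antecedents, supplied by `stub_externalInputs` at the call
site) Qian 2023 Thm. 1.4 at the pinned `p`-adic Hodge data `fontainePstAdicCompletion` (`hQ`), the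
local lemma "near-ordinary ⇒ Qian-ordinary with regular weights at split `p`" (`hOrd`), AHTW 2026
Thm. 1.2.1 at the pinned data (`hHTπ`) and the label-wise base change of labelled Hodge–Tate weights
(`hBC`): an a.e.-unramified `ρ : Γ_F → GL₂(ℚ̄_p)` over an imaginary quadratic `F` with `p` split,
de Rham with labelled weights `{a < b}`, crystalline and with an invariant line at every `v ∣ p`,
carrying Qian's residual package, CANNOT have two labels above `p` with different gaps.  Proof:
Part B (`exists_isAutomorphic_restrictField`) gives `ι`, a CM `K'` Galois over `F` and
`ρ|_{Γ_{K'}}` automorphic; Part A (`false_of_isAutomorphic_of_gap_ne`) derives `False` from the two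
labels with different gaps (exact weights + base change + Clozel purity + `stub_labelExtension`).
[cite: Qian2022, Thm. 1.4] [cite: AHTW2026, Thm. 1.2.1] [cite: Clozel1990, Lemme 4.9]
[cite: BrinonConrad2009, Prop. 6.3.8] -/
theorem stub_ordinaryDihedralVoid :
    ∀ 𝓐 : (∀ (K : Type) [Field K] [NumberField K] (v : HeightOneSpectrum (𝓞 K)), LocalArtinData (v.adicCompletion K)), Qian2022.potentialAutomorphy_ordinary 𝓐 (fun (K : Type) (_ : Field K) (_ : NumberField K) (p : ℕ) (_ : Fact p.Prime) (v : HeightOneSpectrum (𝓞 K)) (hv : ((p : ℕ) : 𝓞 K) ∈ v.asIdeal) => fontainePstAdicCompletion v p hv) → (∀ (F : Type) [Field F] [NumberField F] [Algebra.IsQuadraticExtension ℚ F] (p : ℕ) [Fact p.Prime] (ρ : FramedGaloisRep F (PadicAlgCl p) 2), (∃ v w : HeightOneSpectrum (𝓞 F), v ≠ w ∧ ((p : ℕ) : 𝓞 F) ∈ v.asIdeal ∧ ((p : ℕ) : 𝓞 F) ∈ w.asIdeal) → ∀ (v : HeightOneSpectrum (𝓞 F)) (hv : ((p : ℕ) :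 𝓞 F) ∈ v.asIdeal), (fontainePstAdicCompletion v p hv).IsCrystallineFramed (ρ.toLocal v) → (letI := (fontainePstAdicCompletion v p hv).algebra; ∀ τ : v.adicCompletion F →ₐ[ℚ_[p]] PadicAlgCl p, ∃ a b : ℤ, a < b ∧ ρ.labelledHodgeTateWeightsAt v (fontainePstAdicCompletion v p hv).algebra (fontainePstAdicCompletion v p hv).𝔅 τ.toRingHom = {a, b}) → FramedRep.HasInvariantCompleteFlag (ρ.toLocal v) → ρ.IsOrdinaryRegularAt v (𝓐 F v)) → AHTW2026.hodgeTateWeights_eq (fun (K : Type) (_ : Field K) (_ : NumberField K) (p : ℕ) (_ : Fact p.Prime) (v : HeightOneSpectrum (𝓞 K)) (hv : ((p : ℕ) : 𝓞 K) ∈ v.asIdeal) => fontainePstAdicCompletion v p hv) → LabelledHodgeTateWeightsBaseChangeLabelwise → ∀ (F : Type) [Field F] [NumberField F] [Algebra.IsQuadraticExtension ℚ F], NumberField.IsTotallyComplex F → ∀ (p : ℕ) [Fact p.Prime] (ρ : FramedGaloisRep F (PadicAlgCl p) 2), (∃ v w : HeightOneSpectrum (𝓞 F), v ≠ w ∧ ((p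 : ℕ) : 𝓞 F) ∈ v.asIdeal ∧ ((p : ℕ) : 𝓞 F) ∈ w.asIdeal) → (∀ᶠ v : HeightOneSpectrum (𝓞 F) in Filter.cofinite, ρ.IsUnramifiedAt v) → (∀ (v : HeightOneSpectrum (𝓞 F)) (hv : ((p : ℕ) : 𝓞 F) ∈ v.asIdeal), (fontainePstAdicCompletion v p hv).IsDeRhamFramed (ρ.toLocal v) ∧ (letI := (fontainePstAdicCompletion v p hv).algebra; ∀ τ : v.adicCompletion F →ₐ[ℚ_[p]] PadicAlgCl p, ∃ a b : ℤ, a < b ∧ ρ.labelledHodgeTateWeightsAt v (fontainePstAdicCompletion v p hv).algebra (fontainePstAdicCompletion v p hv).𝔅 τ.toRingHom = {a, b})) → (∀ (v : HeightOneSpectrum (𝓞 F)) (hv : ((p : ℕ) : 𝓞 F) ∈ v.asIdeal), (fontainePstAdicCompletion v p hv).IsCrystallineFramed (ρ.toLocal v)) → (∀ v : HeightOneSpectrum (𝓞 F), ((p : ℕ) : 𝓞 F) ∈ v.asIdeal → FramedRep.HasInvariantCompleteFlag (ρ.toLocal v)) → (ρ.IsResidualRepOf (RingHom.id _) ρ.residualRep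 ∧ IsAbsIrreducible ρ.residualRep ∧ IsDecomposedGeneric ρ.residualRep ∧ IsAbsIrreducible (ρ.residualRep.comp (absGaloisGroupAdjoinRootsOfUnity F p).subtype) ∧ Subgroup.IsEnormous ((absGaloisGroupAdjoinRootsOfUnity F p).map ρ.residualRep) ∧ ∃ σ : absoluteGaloisGroup F, σ ∉ absGaloisGroupAdjoinRootsOfUnity F p ∧ ∃ c : padicAlgClResidueField p, ((ρ.residualRep σ : GL (Fin 2) (padicAlgClResidueField p)) : Matrix (Fin 2) (Fin 2) (padicAlgClResidueField p)) = c • (1 : Matrix (Fin 2) (Fin 2) (padicAlgClResidueField p))) → (∃ (v : HeightOneSpectrum (𝓞 F)) (hv : ((p : ℕ) : 𝓞 F) ∈ v.asIdeal) (w : HeightOneSpectrum (𝓞 F)) (hw : ((p : ℕ) : 𝓞 F) ∈ w.asIdeal), letI := (fontainePstAdicCompletion v p hv).algebra; letI := (fontainePstAdicCompletion w p hw).algebra; ∃ (τ : v.adicCompletion F →ₐ[ℚ_[p]] PadicAlgCl p) (σ : w.adicCompletion F →ₐ[ℚ_[p]] PadicAlgCl p) (a b a' b' : ℤ), ρ.labelledHodgeTateWeightsAt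 v (fontainePstAdicCompletion v p hv).algebra (fontainePstAdicCompletion v p hv).𝔅 τ.toRingHom = {a, b} ∧ a < b ∧ ρ.labelledHodgeTateWeightsAt w (fontainePstAdicCompletion w p hw).algebra (fontainePstAdicCompletion w p hw).𝔅 σ.toRingHom = {a', b'} ∧ a' < b' ∧ b - a ≠ b' - a') → False := by
  intro 𝓐 hQ hOrd hHTπ hBC F _ _ _ hF p _ ρ hsplit hunr hHT hcrys hLR hpkg hNP
  obtain ⟨ι, K', iF, iN, iA, -, hCM', hAut⟩ :=
    exists_isAutomorphic_restrictField 𝓐 hQ hOrd F hF p ρ hsplit hunr hHT hcrys hLR hpkg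
  exact false_of_isAutomorphic_of_gap_ne hHTπ hBC F hF p ρ hNP ι K' hCM' hAut

end Summit.Langlands.Langlands.Theorems.TensorSquareParallel

end
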